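import Summits.NavierStokesRegularity.NavierStokesRegularity.Theorems.FilamentSkeletonRssCoreLinearInvertibilityOddArnoldToolsA
import Literature.Analysis.FluidPDE.PlanarPolarCoords

/-!
# Tools for stub `stub_arnoldModeSplit` (crux `CoreLinearInvertibility`, stmt-NavierStokesRegularity-17973,
# route `FilamentSkeletonRss`, line `Sketch`) — part A: the `k = ±1` circle coefficients

For a continuous planar density `ω` of Gaussian class (`|ω(x)| ≤ C(1+|x|)^N e^{−|x|²/4}`) put, on the
circle of radius `r` (`circlePt r θ = (r cos θ, r sin θ)` of `PlanarPolarCoords`),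
`a(r) = π⁻¹ ∫_{-π}^{π} ω(circlePt r θ) cos θ dθ`, `b(r) = π⁻¹ ∫_{-π}^{π} ω(circlePt r θ) sin θ dθ`
(the real `k = ±1` angular Fourier coefficients), the `k = ±1` part
`ω₁(x) = (a(|x|) x₀ + b(|x|) x₁)/|x|` (`= a(r) cos θ + b(r) sin θ` on the circle of radius `r > 0`,
`0` at the origin) and the remainder `ω_r = ω − ω₁`.  Proved here (elementary):

* the trigonometric integrals over a full turn (`∫ cos² = ∫ sin² = π`, `∫ sin cos = ∫ cos = ∫ sin = 0`);
* `a`, `b` are continuous, vanish at `r = 0`, and are of Gaussian class on `[0, ∞)`;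
* `ω₁` is continuous (at the origin because `a(0) = b(0) = 0`), odd, of Gaussian class, and equals
  `a(r) cos θ + b(r) sin θ` on circles; `ω_r` is continuous, odd (for odd `ω`), of Gaussian class;
* the `k = ±1` circle coefficients of `ω_r` vanish: `∫ ω_r(circlePt r θ) cos θ dθ = ∫ ω_r(circlePt r θ) sin θ dθ = 0`
  for `r > 0`.

Reference for the decomposition: Th. Gallay, V. Šverák, arXiv:2110.13739, §3 (proof of Thm. 2.5:
Fourier decomposition in the angular variable, (Jk), (Bkdef)). Everything in this file is folklore.
-/

set_option linter.dupNamespace false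

noncomputable section

namespace Summit.NavierStokesRegularity.NavierStokesRegularity.Theorems

open Set Function Filter MeasureTheory Topology
open Literature.Analysis.FluidPDE
open scoped Real

/-! ### Trigonometric integrals over a full turn -/

/-- `∫_{-π}^{π} cos² = π`. [folklore] -/
theorem modeSplit_integral_cos_sq : ∫ θ in (-π)..π, Real.cos θ ^ 2 = π := by
  rw [integral_cos_sq]
  simp [Real.sin_neg]

/-- `∫_{-π}^{π} sin² = π`. [folklore] -/
theorem modeSplit_integral_sin_sq : ∫ θ in (-π)..π, Real.sin θ ^ 2 = π := by
  rw [integral_sin_sq]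
  simp [Real.sin_neg]

/-- `∫_{-π}^{π} sin θ cos θ dθ = 0`. [folklore] -/
theorem modeSplit_integral_sin_mul_cos : ∫ θ in (-π)..π, Real.sin θ * Real.cos θ = 0 := by
  rw [integral_sin_mul_cos₁]
  simp [Real.sin_neg]

/-- `∫_{-π}^{π} cos = 0`. [folklore] -/
theorem modeSplit_integral_cos : ∫ θ in (-π)..π, Real.cos θ = 0 := by
  rw [integral_cos]
  simp [Real.sin_neg]

/-- `∫_{-π}^{π} sin = 0`. [folklore] -/
theorem modeSplit_integral_sin : ∫ θ in (-π)..π, Real.sin θ = 0 := by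
  rw [integral_sin]
  simp [Real.cos_neg]

/-! ### Circle integrals `∫ ω(circlePt r θ) w(θ) dθ` of a continuous density -/

/-- `r ↦ ∫_{-π}^{π} ω(circlePt r θ) w(θ) dθ` is continuous for continuous `ω`, `w` (parametric interval
integral of a continuous integrand). [folklore] -/
theorem modeSplit_continuous_circleInt {om : EuclideanSpace ℝ (Fin 2) → ℝ} (hom : Continuous om) {w : ℝ → ℝ}
    (hw : Continuous w) : Continuous fun r => ∫ θ in (-π)..π, om (circlePt r θ) * w θ :=
  intervalIntegral.continuous_parametric_intervalIntegral_of_continuous'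
    (f := fun r θ => om (circlePt r θ) * w θ)
    ((hom.comp continuous_circlePt_uncurry).mul (hw.comp continuous_snd)) _ _

/-- On the circle of radius `0` the integral is `ω(0) ∫ w = 0` when `∫_{-π}^{π} w = 0`. [folklore] -/
theorem modeSplit_circleInt_zero (om : EuclideanSpace ℝ (Fin 2) → ℝ) {w : ℝ → ℝ} (hw0 : ∫ θ in (-π)..π, w θ = 0) :
    ∫ θ in (-π)..π, om (circlePt 0 θ) * w θ = 0 := by
  simp only [circlePt_zero_left]
  rw [intervalIntegral.integral_const_mul, hw0, mul_zero]

/-- `θ ↦ ω(circlePt r θ) w(θ)` is interval integrable for continuous `ω`, `w`. [folklore] -/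
theorem modeSplit_intervalIntegrable_circle {om : EuclideanSpace ℝ (Fin 2) → ℝ} (hom : Continuous om) {w : ℝ → ℝ}
    (hw : Continuous w) (r c d : ℝ) :
    IntervalIntegrable (fun θ => om (circlePt r θ) * w θ) volume c d :=
  ((hom.comp (continuous_circlePt r)).mul hw).intervalIntegrable _ _

/-- **Gaussian bound for circle integrals**: `|∫_{-π}^{π} ω(circlePt r θ) w(θ) dθ| ≤ 2π C(1+|r|)^N e^{−r²/4}`
when `|ω(x)| ≤ C(1+|x|)^N e^{−|x|²/4}` and `|w| ≤ 1` (`|circlePt r θ| = |r|`). [folklore] -/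
theorem modeSplit_abs_circleInt_le {om : EuclideanSpace ℝ (Fin 2) → ℝ} {C : ℝ} {N : ℕ}
    (hC : ∀ x, |om x| ≤ C * (1 + ‖x‖) ^ N * Real.exp (-(‖x‖ ^ 2 / 4)))
    {w : ℝ → ℝ} (hw : ∀ θ, |w θ| ≤ 1) (r : ℝ) :
    |∫ θ in (-π)..π, om (circlePt r θ) * w θ| ≤
      2 * π * (C * (1 + |r|) ^ N * Real.exp (-(r ^ 2 / 4))) := by
  have hC0 : 0 ≤ C := arnold_gc_const_nonneg hC
  have h := intervalIntegral.norm_integral_le_of_norm_le_const (a := -π) (b := π)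
    (C := C * (1 + |r|) ^ N * Real.exp (-(r ^ 2 / 4))) (f := fun θ => om (circlePt r θ) * w θ)
    (fun θ _ => by
      rw [Real.norm_eq_abs, abs_mul]
      have h1 := hC (circlePt r θ)
      rw [norm_circlePt, sq_abs] at h1
      calc |om (circlePt r θ)| * |w θ| ≤ C * (1 + |r|) ^ N * Real.exp (-(r ^ 2 / 4)) * 1 :=
            mul_le_mul h1 (hw θ) (abs_nonneg _) (by positivity)
        _ = _ := mul_one _)
  rw [Real.norm_eq_abs, sub_neg_eq_add, ← two_mul, abs_of_pos Real.two_pi_pos] at h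
  linarith

/-! ### The coefficients `a`, `b` -/

section Coeff

variable {om : EuclideanSpace ℝ (Fin 2) → ℝ} {a b : ℝ → ℝ}

/-- `a` (or `b`) is continuous. [folklore] -/
theorem modeSplit_continuous_coeff (hom : Continuous om) {w : ℝ → ℝ} (hw : Continuous w)
    (ha : ∀ r, a r = (1 / Real.pi) * ∫ θ in (-Real.pi)..Real.pi, om (circlePt r θ) * w θ) :
    Continuous a := by
  rw [show a = fun r => (1 / Real.pi) * ∫ θ in (-Real.pi)..Real.pi, om (circlePt r θ) * w θ from
    funext ha]
  exact continuous_const.mul (modeSplit_continuous_circleInt hom hw)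

/-- `a(0) = 0` (resp. `b(0) = 0`): `∫ cos = ∫ sin = 0`. [folklore] -/
theorem modeSplit_coeff_zero {w : ℝ → ℝ} (hw0 : ∫ θ in (-π)..π, w θ = 0)
    (ha : ∀ r, a r = (1 / Real.pi) * ∫ θ in (-Real.pi)..Real.pi, om (circlePt r θ) * w θ) :
    a 0 = 0 := by
  rw [ha, modeSplit_circleInt_zero om hw0, mul_zero]

/-- `∫ ω(circlePt r θ) w θ dθ = π a(r)`. [folklore] -/
theorem modeSplit_circleInt_eq_pi_mul {w : ℝ → ℝ}
    (ha : ∀ r, a r = (1 / Real.pi) * ∫ θ in (-Real.pi)..Real.pi, om (circlePt r θ) * w θ) (r : ℝ) :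
    ∫ θ in (-π)..π, om (circlePt r θ) * w θ = π * a r := by
  rw [ha r]
  field_simp

/-- **`a`, `b` are of Gaussian class**: `|a(r)| ≤ 2C(1+|r|)^N e^{−r²/4}` for every `r` when
`|ω(x)| ≤ C(1+|x|)^N e^{−|x|²/4}` and `|w| ≤ 1`. [folklore] -/
theorem modeSplit_abs_coeff_le {C : ℝ} {N : ℕ}
    (hC : ∀ x, |om x| ≤ C * (1 + ‖x‖) ^ N * Real.exp (-(‖x‖ ^ 2 / 4)))
    {w : ℝ → ℝ} (hw : ∀ θ, |w θ| ≤ 1)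
    (ha : ∀ r, a r = (1 / Real.pi) * ∫ θ in (-Real.pi)..Real.pi, om (circlePt r θ) * w θ) (r : ℝ) :
    |a r| ≤ 2 * C * (1 + |r|) ^ N * Real.exp (-(r ^ 2 / 4)) := by
  have h := modeSplit_abs_circleInt_le hC hw r
  rw [ha r, abs_mul, abs_of_pos (by positivity : (0 : ℝ) < 1 / Real.pi)]
  calc 1 / π * |∫ θ in (-π)..π, om (circlePt r θ) * w θ|
      ≤ 1 / π * (2 * π * (C * (1 + |r|) ^ N * Real.exp (-(r ^ 2 / 4)))) :=
        mul_le_mul_of_nonneg_left h (by positivity)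
    _ = 2 * C * (1 + |r|) ^ N * Real.exp (-(r ^ 2 / 4)) := by
        field_simp

/-- The Gaussian-class bound of `a`, `b` on `[0, ∞)` in the registered form. [folklore] -/
theorem modeSplit_coeff_gaussClass
    (hgc : ∃ (C : ℝ) (N : ℕ), ∀ x, |om x| ≤ C * (1 + ‖x‖) ^ N * Real.exp (-(‖x‖ ^ 2 / 4)))
    (ha : ∀ r, a r = (1 / Real.pi) * ∫ θ in (-Real.pi)..Real.pi, om (circlePt r θ) * Real.cos θ)
    (hb : ∀ r, b r = (1 / Real.pi) * ∫ θ in (-Real.pi)..Real.pi, om (circlePt r θ) * Real.sin θ) :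
    ∃ (C : ℝ) (N : ℕ), ∀ r : ℝ, 0 ≤ r →
      |a r| ≤ C * (1 + r) ^ N * Real.exp (-(r ^ 2 / 4)) ∧
      |b r| ≤ C * (1 + r) ^ N * Real.exp (-(r ^ 2 / 4)) := by
  obtain ⟨C, N, hC⟩ := hgc
  refine ⟨2 * C, N, fun r hr => ?_⟩
  have h1 := modeSplit_abs_coeff_le hC Real.abs_cos_le_one ha r
  have h2 := modeSplit_abs_coeff_le hC Real.abs_sin_le_one hb r
  rw [abs_of_nonneg hr] at h1 h2
  exact ⟨h1, h2⟩

end Coeff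

/-! ### The `k = ±1` part `ω₁` and the remainder `ω_r` -/

section ModeOne

variable {om : EuclideanSpace ℝ (Fin 2) → ℝ} {a b : ℝ → ℝ} {om₁ omr : EuclideanSpace ℝ (Fin 2) → ℝ}

/-- On the circle of radius `r > 0`: `ω₁(circlePt r θ) = a(r) cos θ + b(r) sin θ`. [folklore] -/
theorem modeSplit_om₁_circlePt (hom₁ : ∀ x, om₁ x = (a ‖x‖ * x 0 + b ‖x‖ * x 1) / ‖x‖) {r : ℝ}
    (hr : 0 < r) (θ : ℝ) : om₁ (circlePt r θ) = a r * Real.cos θ + b r * Real.sin θ := by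
  rw [hom₁, norm_circlePt, abs_of_pos hr, circlePt_apply_zero, circlePt_apply_one]
  field_simp

/-- `|ω₁(x)| ≤ |a(|x|)| + |b(|x|)|` (`|x_j| ≤ |x|`). [folklore] -/
theorem modeSplit_abs_om₁_le (hom₁ : ∀ x, om₁ x = (a ‖x‖ * x 0 + b ‖x‖ * x 1) / ‖x‖) (x : EuclideanSpace ℝ (Fin 2)) :
    |om₁ x| ≤ |a ‖x‖| + |b ‖x‖| := by
  rw [hom₁]
  rcases eq_or_ne x 0 with rfl | hx
  · simp only [norm_zero, div_zero, abs_zero]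
    positivity
  · have hn : 0 < ‖x‖ := norm_pos_iff.2 hx
    have h0 : |x 0| ≤ ‖x‖ := by simpa using PiLp.norm_apply_le x 0
    have h1 : |x 1| ≤ ‖x‖ := by simpa using PiLp.norm_apply_le x 1
    rw [abs_div, abs_of_pos hn, div_le_iff₀ hn]
    calc |a ‖x‖ * x 0 + b ‖x‖ * x 1| ≤ |a ‖x‖| * |x 0| + |b ‖x‖| * |x 1| := by
          simpa only [abs_mul] using abs_add_le (a ‖x‖ * x 0) (b ‖x‖ * x 1)
      _ ≤ |a ‖x‖| * ‖x‖ + |b ‖x‖| * ‖x‖ := by gcongr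
      _ = (|a ‖x‖| + |b ‖x‖|) * ‖x‖ := by ring

/-- `ω₁(0) = 0`. [folklore] -/
theorem modeSplit_om₁_zero (hom₁ : ∀ x, om₁ x = (a ‖x‖ * x 0 + b ‖x‖ * x 1) / ‖x‖) : om₁ 0 = 0 := by
  rw [hom₁]; simp

/-- **`ω₁` is continuous**: off the origin by the formula, at the origin because
`|ω₁(x)| ≤ |a(|x|)| + |b(|x|)| → |a(0)| + |b(0)| = 0`. [folklore] -/
theorem modeSplit_continuous_om₁ (hac : Continuous a) (hbc : Continuous b) (ha0 : a 0 = 0)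
    (hb0 : b 0 = 0) (hom₁ : ∀ x, om₁ x = (a ‖x‖ * x 0 + b ‖x‖ * x 1) / ‖x‖) : Continuous om₁ := by
  have heq : om₁ = fun x => (a ‖x‖ * x 0 + b ‖x‖ * x 1) / ‖x‖ := funext hom₁
  have hnum : Continuous fun x : EuclideanSpace ℝ (Fin 2) => a ‖x‖ * x 0 + b ‖x‖ * x 1 :=
    ((hac.comp continuous_norm).mul (PiLp.continuous_apply 2 _ 0)).add
      ((hbc.comp continuous_norm).mul (PiLp.continuous_apply 2 _ 1))
  refine continuous_iff_continuousAt.2 fun x => ?_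
  rcases eq_or_ne x 0 with rfl | hx
  · change Tendsto om₁ (𝓝 0) (𝓝 (om₁ 0))
    rw [modeSplit_om₁_zero hom₁]
    have hg : Tendsto (fun x : EuclideanSpace ℝ (Fin 2) => |a ‖x‖| + |b ‖x‖|) (𝓝 0) (𝓝 0) := by
      have hc : Continuous fun x : EuclideanSpace ℝ (Fin 2) => |a ‖x‖| + |b ‖x‖| :=
        (continuous_abs.comp (hac.comp continuous_norm)).add
          (continuous_abs.comp (hbc.comp continuous_norm))
      simpa [ha0, hb0] using hc.tendsto 0
    exact squeeze_zero_norm (fun x => by rw [Real.norm_eq_abs]; exact modeSplit_abs_om₁_le hom₁ x) hg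
  · rw [heq]
    exact hnum.continuousAt.div continuous_norm.continuousAt (norm_ne_zero_iff.2 hx)

/-- `ω₁` is odd. [folklore] -/
theorem modeSplit_om₁_odd (hom₁ : ∀ x, om₁ x = (a ‖x‖ * x 0 + b ‖x‖ * x 1) / ‖x‖) (x : EuclideanSpace ℝ (Fin 2)) :
    om₁ (-x) = -om₁ x := by
  rw [hom₁, hom₁ x, norm_neg, PiLp.neg_apply, PiLp.neg_apply]
  ring

/-- **`ω₁` is of Gaussian class** (`|ω₁| ≤ |a| + |b| ≤ 4C(1+|x|)^N e^{−|x|²/4}`). [folklore] -/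
theorem modeSplit_om₁_gaussClass {C : ℝ} {N : ℕ}
    (hC : ∀ x, |om x| ≤ C * (1 + ‖x‖) ^ N * Real.exp (-(‖x‖ ^ 2 / 4)))
    (ha : ∀ r, a r = (1 / Real.pi) * ∫ θ in (-Real.pi)..Real.pi, om (circlePt r θ) * Real.cos θ)
    (hb : ∀ r, b r = (1 / Real.pi) * ∫ θ in (-Real.pi)..Real.pi, om (circlePt r θ) * Real.sin θ)
    (hom₁ : ∀ x, om₁ x = (a ‖x‖ * x 0 + b ‖x‖ * x 1) / ‖x‖) (x : EuclideanSpace ℝ (Fin 2)) :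
    |om₁ x| ≤ 4 * C * (1 + ‖x‖) ^ N * Real.exp (-(‖x‖ ^ 2 / 4)) := by
  have h1 := modeSplit_abs_coeff_le hC Real.abs_cos_le_one ha ‖x‖
  have h2 := modeSplit_abs_coeff_le hC Real.abs_sin_le_one hb ‖x‖
  rw [abs_norm] at h1 h2
  have h := modeSplit_abs_om₁_le hom₁ x
  linarith

/-- `ω_r = ω − ω₁` is continuous. [folklore] -/
theorem modeSplit_continuous_omr (hom : Continuous om) (hom₁c : Continuous om₁)
    (homr : ∀ x, omr x = om x - om₁ x) : Continuous omr := by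
  rw [show omr = fun x => om x - om₁ x from funext homr]
  exact hom.sub hom₁c

/-- `ω_r` is odd when `ω` is. [folklore] -/
theorem modeSplit_omr_odd (hodd : ∀ x, om (-x) = -om x)
    (hom₁ : ∀ x, om₁ x = (a ‖x‖ * x 0 + b ‖x‖ * x 1) / ‖x‖) (homr : ∀ x, omr x = om x - om₁ x)
    (x : EuclideanSpace ℝ (Fin 2)) : omr (-x) = -omr x := by
  rw [homr, homr x, hodd, modeSplit_om₁_odd hom₁]
  ring

/-- **`ω_r` is of Gaussian class** (`|ω_r| ≤ |ω| + |ω₁| ≤ 5C(1+|x|)^N e^{−|x|²/4}`). [folklore] -/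
theorem modeSplit_omr_gaussClass {C : ℝ} {N : ℕ}
    (hC : ∀ x, |om x| ≤ C * (1 + ‖x‖) ^ N * Real.exp (-(‖x‖ ^ 2 / 4)))
    (ha : ∀ r, a r = (1 / Real.pi) * ∫ θ in (-Real.pi)..Real.pi, om (circlePt r θ) * Real.cos θ)
    (hb : ∀ r, b r = (1 / Real.pi) * ∫ θ in (-Real.pi)..Real.pi, om (circlePt r θ) * Real.sin θ)
    (hom₁ : ∀ x, om₁ x = (a ‖x‖ * x 0 + b ‖x‖ * x 1) / ‖x‖) (homr : ∀ x, omr x = om x - om₁ x)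
    (x : EuclideanSpace ℝ (Fin 2)) : |omr x| ≤ 5 * C * (1 + ‖x‖) ^ N * Real.exp (-(‖x‖ ^ 2 / 4)) := by
  have h1 := modeSplit_om₁_gaussClass hC ha hb hom₁ x
  have h2 := hC x
  rw [homr]
  have h := abs_sub (om x) (om₁ x)
  linarith

/-- **The `k = ±1` circle coefficients of `ω_r` vanish**: for `r > 0`,
`∫_{-π}^{π} ω_r(circlePt r θ) cos θ dθ = 0` (`∫ ω cos = π a`, `∫ cos² = π`, `∫ sin cos = 0`). [folklore] -/
theorem modeSplit_omr_circle_cos (hom : Continuous om)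
    (ha : ∀ r, a r = (1 / Real.pi) * ∫ θ in (-Real.pi)..Real.pi, om (circlePt r θ) * Real.cos θ)
    (hom₁ : ∀ x, om₁ x = (a ‖x‖ * x 0 + b ‖x‖ * x 1) / ‖x‖) (homr : ∀ x, omr x = om x - om₁ x)
    {r : ℝ} (hr : 0 < r) : ∫ θ in (-π)..π, omr (circlePt r θ) * Real.cos θ = 0 := by
  have h1 : ∀ θ, omr (circlePt r θ) * Real.cos θ = om (circlePt r θ) * Real.cos θ -
      a r * Real.cos θ ^ 2 - b r * (Real.sin θ * Real.cos θ) := by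
    intro θ; rw [homr, modeSplit_om₁_circlePt hom₁ hr]; ring
  simp_rw [h1]
  have i1 := modeSplit_intervalIntegrable_circle hom Real.continuous_cos r (-π) π
  have i2 : IntervalIntegrable (fun θ => a r * Real.cos θ ^ 2) volume (-π) π :=
    (continuous_const.mul (Real.continuous_cos.pow 2)).intervalIntegrable _ _
  have i3 : IntervalIntegrable (fun θ => b r * (Real.sin θ * Real.cos θ)) volume (-π) π :=
    (continuous_const.mul (Real.continuous_sin.mul Real.continuous_cos)).intervalIntegrable _ _
  rw [intervalIntegral.integral_sub (i1.sub i2) i3, intervalIntegral.integral_sub i1 i2,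
    intervalIntegral.integral_const_mul, intervalIntegral.integral_const_mul,
    modeSplit_integral_cos_sq, modeSplit_integral_sin_mul_cos, modeSplit_circleInt_eq_pi_mul ha r]
  ring

/-- The same with `sin`: `∫_{-π}^{π} ω_r(circlePt r θ) sin θ dθ = 0` for `r > 0`. [folklore] -/
theorem modeSplit_omr_circle_sin (hom : Continuous om)
    (hb : ∀ r, b r = (1 / Real.pi) * ∫ θ in (-Real.pi)..Real.pi, om (circlePt r θ) * Real.sin θ)
    (hom₁ : ∀ x, om₁ x = (a ‖x‖ * x 0 + b ‖x‖ * x 1) / ‖x‖) (homr : ∀ x, omr x = om x - om₁ x)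
    {r : ℝ} (hr : 0 < r) : ∫ θ in (-π)..π, omr (circlePt r θ) * Real.sin θ = 0 := by
  have h1 : ∀ θ, omr (circlePt r θ) * Real.sin θ = om (circlePt r θ) * Real.sin θ -
      a r * (Real.sin θ * Real.cos θ) - b r * Real.sin θ ^ 2 := by
    intro θ; rw [homr, modeSplit_om₁_circlePt hom₁ hr]; ring
  simp_rw [h1]
  have i1 := modeSplit_intervalIntegrable_circle hom Real.continuous_sin r (-π) π
  have i2 : IntervalIntegrable (fun θ => a r * (Real.sin θ * Real.cos θ)) volume (-π) π :=
    (continuous_const.mul (Real.continuous_sin.mul Real.continuous_cos)).intervalIntegrable _ _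
  have i3 : IntervalIntegrable (fun θ => b r * Real.sin θ ^ 2) volume (-π) π :=
    (continuous_const.mul (Real.continuous_sin.pow 2)).intervalIntegrable _ _
  rw [intervalIntegral.integral_sub (i1.sub i2) i3, intervalIntegral.integral_sub i1 i2,
    intervalIntegral.integral_const_mul, intervalIntegral.integral_const_mul,
    modeSplit_integral_sin_sq, modeSplit_integral_sin_mul_cos, modeSplit_circleInt_eq_pi_mul hb r]
  ring

end ModeOne

/-! ### The registered tools stub -/

/-- **Registered tools stub `stub_arnoldModeSplitToolsA`** (helpers for `stub_arnoldModeSplit`, line `Sketch`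
of crux `CoreLinearInvertibility`, stmt-NavierStokesRegularity-17973): for a continuous Gaussian-class `ω`
with circle coefficients `a`, `b`, `k = ±1` part `ω₁` and remainder `ω_r`: continuity of `a`, `b`, `ω₁`,
`ω_r`, `a(0) = b(0) = 0`, oddness of `ω₁`, `ω₁ = a cos θ + b sin θ` on circles, Gaussian class of `ω₁`,
`ω_r`, and the vanishing of the `k = ±1` circle coefficients of `ω_r`. [folklore] -/
theorem stub_arnoldModeSplitToolsA :
    ∀ (om : EuclideanSpace ℝ (Fin 2) → ℝ) (a b : ℝ → ℝ) (om₁ omr : EuclideanSpace ℝ (Fin 2) → ℝ),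
    Continuous om →
    (∃ (C : ℝ) (N : ℕ), ∀ x, |om x| ≤ C * (1 + ‖x‖) ^ N * Real.exp (-(‖x‖ ^ 2 / 4))) →
    (∀ r, a r = (1 / Real.pi) * ∫ θ in (-Real.pi)..Real.pi, om (circlePt r θ) * Real.cos θ) →
    (∀ r, b r = (1 / Real.pi) * ∫ θ in (-Real.pi)..Real.pi, om (circlePt r θ) * Real.sin θ) →
    (∀ x, om₁ x = (a ‖x‖ * x 0 + b ‖x‖ * x 1) / ‖x‖) →
    (∀ x, omr x = om x - om₁ x) →
    Continuous a ∧ Continuous b ∧ a 0 = 0 ∧ b 0 = 0 ∧ Continuous om₁ ∧ Continuous omr ∧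
    (∀ x, om₁ (-x) = -om₁ x) ∧
    (∀ (r θ : ℝ), 0 < r → om₁ (circlePt r θ) = a r * Real.cos θ + b r * Real.sin θ) ∧
    (∃ (C : ℝ) (N : ℕ), ∀ x, |om₁ x| ≤ C * (1 + ‖x‖) ^ N * Real.exp (-(‖x‖ ^ 2 / 4)) ∧
      |omr x| ≤ C * (1 + ‖x‖) ^ N * Real.exp (-(‖x‖ ^ 2 / 4))) ∧
    (∀ r : ℝ, 0 < r → ∫ θ in (-Real.pi)..Real.pi, omr (circlePt r θ) * Real.cos θ = 0 ∧
      ∫ θ in (-Real.pi)..Real.pi, omr (circlePt r θ) * Real.sin θ = 0) := by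
  intro om a b om₁ omr hom hgc ha hb hom₁ homr
  obtain ⟨C, N, hC⟩ := hgc
  have hC0 : 0 ≤ C := arnold_gc_const_nonneg hC
  have hac : Continuous a := modeSplit_continuous_coeff hom Real.continuous_cos ha
  have hbc : Continuous b := modeSplit_continuous_coeff hom Real.continuous_sin hb
  have ha0 : a 0 = 0 := modeSplit_coeff_zero modeSplit_integral_cos ha
  have hb0 : b 0 = 0 := modeSplit_coeff_zero modeSplit_integral_sin hb
  have hom₁c : Continuous om₁ := modeSplit_continuous_om₁ hac hbc ha0 hb0 hom₁
  refine ⟨hac, hbc, ha0, hb0, hom₁c, modeSplit_continuous_omr hom hom₁c homr, modeSplit_om₁_odd hom₁,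
    fun r θ hr => modeSplit_om₁_circlePt hom₁ hr θ, ⟨5 * C, N, fun x => ⟨?_, ?_⟩⟩, fun r hr =>
    ⟨modeSplit_omr_circle_cos hom ha hom₁ homr hr, modeSplit_omr_circle_sin hom hb hom₁ homr hr⟩⟩
  · refine (modeSplit_om₁_gaussClass hC ha hb hom₁ x).trans ?_
    gcongr
    linarith
  · exact modeSplit_omr_gaussClass hC ha hb hom₁ homr x

end Summit.NavierStokesRegularity.NavierStokesRegularity.Theorems
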